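import Summits.QuantumFields.YangMills.Theorems.BalabanUVNodesN15KingModelAnalyticBlockCovDeterminant
import HarnessLib

/-!
# BalabanUVNodes ∕ N15 — THE KING-MODEL RUNG (PART Ϫ-h, `𝕜 = ℂ`): THE BLOCK-FIELD COVARIANCE IN THE COMPLEX WINDOW — THE PACKAGE, THE REAL SLICE REVISITED, AND WHAT THE
# COMPLEXIFICATION ADDS — ★★★★ at EVERY unitary background `U` (any curvature) King's effective Laplacian has the `η`-UNIFORM FORM FLOOR `β₁‖g‖² ≤ ⟨g,Δ_eff(U)g⟩`,
# `β₁ = (a⁻¹∕2)∕(a⁻¹+4e∕m²)²` (read off from the complex theory at `ε → 0`), and `‖Δ_eff(U)‖ ≤ Γ₁`; ★★★★ the PACKAGE: around every unitary `U₀`, on `Lε ≤ s₀(m²,a,d)`, NE2's unit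
# layer `(Δ_eff(U,U⁻¹))⁻¹` exists, IS the Woodbury form, is bounded by `a⁻¹ + 4e∕m²`, decays like King's `C^{(k)}` ((4.32)–(4.34)), is holomorphic, is Lipschitz in the background with the decay, and in the
# accretivity window `Δ_eff(U,U⁻¹)` is strictly accretive with `β₁^N ≤ |det| ≤ Γ₁^N`; ★★★ HONESTY: the radius is `≤ m²∕(240(d+1)(1+a))` (it closes with the fine mass), the Woodbury form
# continues past the certified window of `Δ_eff`, and on the real slice PART Ϥ-k's exact sandwich is sharper than `β₁`
# (Track A, DAG node N15 = NE2; FAN-OUT v1.1 §N15 s3 «KING-MODEL RUNG … + what the curved case adds»; count-neutral)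

HONEST FRAMING.  Count-neutral (cell `pub-ymgap`, seat `pub-ymgap-dag-n15-e` g52; `--supports stmt-QuantumFields-27247 --as helper` = K3ᴬ, KEY MAP v3).  King's one-level comparison model,
massive fine covariance `m² > 0`, fibre `ℂⁿ`, King's scaling `c = L²`, comb-depth contours `T`.  Conjunctions of PARTS Ϫ-a … Ϫ-g by name; the real-slice floor is a COROLLARY of the
complex accretivity (no spectral theorem), with a crude constant.  NOT Bałaban's multi-level `C^{(k)}(U)`; NOT a node discharge (N15 of record untouched); nothing continuum ∕ ℝ⁴ ∕ OS ∕ Clay.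

ERRATUM-Ϫ1 (v1.1, DOC-ONLY; ref-I READ-1090 N1, verified first-hand on the held page p.674 of [King1986]): (4.32) defines `C^{(k)}_Ω(s)`; the sentence after it states that `C^{(k)}_Ω(s)` «has uniform exponential decay» once (4.33) (the lower bound `C ≥ γ₀I`) and (4.34) (decay of `C⁻¹`) hold; (4.35)–(4.37) are the momentum sums proving (4.33); Lemma 4.5 = (4.38) is the two-spacing difference WITH decay; (4.44) p.675 is the resolvent∕Woodbury-type difference identity and (4.45) its Fourier representation.  v1.0 of this file cited «(4.37)» for the decay of `C^{(k)}` and «(4.45)» for the Woodbury form ∕ floors; v1.1 cites (4.32)–(4.34) for the decay, (4.38) for Lipschitz-with-decay shapes, (4.33) for lower bounds ∕ floors and (4.44) for the Woodbury form.  Declarations byte-identical to v1.0.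

THE RESULTS:
* §1 THE REAL SLICE REVISITED (every unitary `U`, `a, m² > 0`, `L ≥ 1`): `exists_accretivity_radius` (an admissible `ε > 0`), ★★★★ **`re_quadForm_effLapU_ge_uniform`** (`β₁‖g‖² ≤ Re⟨g,Δ_eff(U)g⟩` —
  KING's EFFECTIVE LAPLACIAN HAS AN `η`-UNIFORM FORM FLOOR AT EVERY CURVED BACKGROUND), ★★★ `re_eigenvalue_effLapU_ge_uniform`, ★★★ `l2_opNorm_effLapU_le_uniform` (`‖Δ_eff(U)‖ ≤ Γ₁`),
  ★★★ `norm_det_effLapU_two_sided` (`β₁^N ≤ |det Δ_eff(U)| ≤ Γ₁^N` at every unitary `U`).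
* §2 ★★★★ **`king_blockCov_complex_window_package`** (around every unitary `U₀`: on `Lε ≤ s₀(m²,a,d)` — invertibility of `Δ_eff(U,U⁻¹)` with inverse the Woodbury form, `‖C‖ ≤ a⁻¹+4e∕m²`, King's `C^{(k)}`
  block decay ((4.32)–(4.34)), holomorphy of `U ↦ (Δ_eff(U,U⁻¹))⁻¹` on the open polydisc; on `2Lε ≤ s₀(m²,0,d)` — Lipschitz with decay; in the accretivity window — `Re Δ_eff ≥ β₁`, `β₁^N ≤ |det| ≤ Γ₁^N`).
* §3 ★★★ **`king_blockCov_what_the_complexification_adds`** (honesty: `s₀(m²,a,d) ≤ m²∕(240(d+1)(1+a))`; the Woodbury form is analytic on the larger polydisc `s₀(m²,0,d)`; on the real slice the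
  exact sandwich `a⁻¹ ≤ (Δ_eff(U))⁻¹ ≤ a⁻¹+m⁻²` of PART Ϥ-k holds at every `U`).
PRIOR TREE ART (by name): Ϫ-a … Ϫ-g (`cxBlockCov`, `inv_cxEffLap_at_massRadius`, `l2_opNorm_cxBlockCov_at_massRadius_le`, `norm_blk_cxBlockCov_at_massRadius_le`, `analyticOnNhd_inv_printEffLap_polydisc`,
`norm_blk_cxBlockCov_sub_le_eta_uniform`, `re_quadForm_cxEffLap_ge`, `pow_le_norm_det_cxEffLap`, `norm_det_cxEffLap_le_pow`, `l2_opNorm_cxEffLap_at_massRadius_le`, `covLip`, `covLip_nonneg`, `sliceRadius_anti`),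
Ϩ-l (`cxEffLap_inv_of_unitary`), Ϩ-g (`sliceRadius`, `sliceRadius_pos`, `sliceRadius_le`), Ϥ-k (`king_blockField_covariance_sandwich`), Ϫ-d (`analyticOnNhd_printBlockCov_polydisc`).  Dedup (rg at filing): basename 0 files;
needles `re_quadForm_effLapU_ge_uniform|king_blockCov_complex_window_package|exists_accretivity_radius` 0 tree files.  Locators: [King1986] (2.14) p.653, (4.5) p.670, (4.32)–(4.34) p.674, (4.33) p.674, Lemma 4.5 (4.38) p.674, (4.44) p.675;
[Balaban1985BackgroundPropagators] (3.25) p.394, §3.B p.399 l.37–40, Thm 3.4 p.400.  0 `sorry`, 0 `def`.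
-/

noncomputable section
open scoped BigOperators ComplexConjugate ComplexOrder Matrix.Norms.L2Operator
open Finset Matrix WithLp

namespace Summit.QuantumFields.YangMills.BalabanUVNodes.N15KingModelRung.Analytic

open Literature.MathematicalPhysics.QuantumFieldTheory.LatticeDiamagneticInequality (blk)
open Literature.MathematicalPhysics.QuantumFieldTheory.Balaban1983to89 (B4Sect5Proof.latticeConst)
open Literature.MathematicalPhysics.QuantumFieldTheory.Balaban1983to89.B5Prop11Plancherel (Tor fine)
open Literature.MathematicalPhysics.QuantumFieldTheory.King1986.Torus (tdistT)
open Summit.QuantumFields.YangMills.BalabanUVNodes.N15KingModelRung.Covariant (fib)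
open Summit.QuantumFields.YangMills.BalabanUVNodes.N15KingModelRung.CovariantBlock (BlockTree covQ fullOpU effLapU king_blockField_covariance_sandwich)
open Summit.QuantumFields.YangMills.BalabanUVNodes.N15KingModelRung.CombesThomas (ctRate)

variable {d : ℕ} {L : ℕ} [NeZero L] (T : BlockTree d L) (M : Fin (d + 1) → ℕ) [hM : ∀ μ, NeZero (M μ)]
variable {n : Type*} [Fintype n] [DecidableEq n]

/-! ## §1 The real slice revisited: an `η`-uniform form floor for King's `Δ_eff(U)` at every curved background -/

section RealSlice

variable (hD : ∀ j, T.depth j ≤ (d + 1) * (L - 1)) {a m2 : ℝ} (ha : 0 < a) (hm : 0 < m2) (hL : 1 ≤ L)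
variable {U : Tor (fine L M) × Fin (d + 1) → Matrix n n ℂ} (hU : ∀ bd, U bd ∈ Matrix.unitaryGroup n ℂ)
include hD ha hm hL hU

omit [NeZero L] hD hU in
/-- AN ADMISSIBLE RADIUS: some `ε > 0` satisfies both the accretivity-window inequalities `2Lε ≤ s₀(m²,a,d)` and `covLip(m²,d)·Lε∕s₀(m²,0,d) ≤ a⁻¹∕2`. [folklore] -/
theorem exists_accretivity_radius : ∃ ε : ℝ, 0 < ε ∧ 2 * ((L : ℝ) * ε) ≤ sliceRadius m2 a d ∧ covLip m2 d * ((L : ℝ) * ε / sliceRadius m2 0 d) ≤ a⁻¹ / 2 := by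
  have hL0 : (0 : ℝ) < L := by exact_mod_cast hL
  have hs : 0 < sliceRadius m2 a d := sliceRadius_pos hm ha.le d
  have hs0 : 0 < sliceRadius m2 0 d := sliceRadius_pos hm le_rfl d
  have hK : 0 ≤ covLip m2 d := covLip_nonneg hm d
  set ε : ℝ := min (sliceRadius m2 a d / (2 * L)) (a⁻¹ / 2 * sliceRadius m2 0 d / ((L : ℝ) * (covLip m2 d + 1))) with hε
  have hε1 : ε ≤ sliceRadius m2 a d / (2 * L) := min_le_left _ _
  have hε2 : ε ≤ a⁻¹ / 2 * sliceRadius m2 0 d / ((L : ℝ) * (covLip m2 d + 1)) := min_le_right _ _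
  refine ⟨ε, lt_min (by positivity) (by positivity), ?_, ?_⟩
  · rw [le_div_iff₀ (by positivity)] at hε1; linarith
  · rw [le_div_iff₀ (by positivity)] at hε2
    rw [mul_div_assoc', div_le_iff₀ hs0]
    -- `covLip·Lε ≤ (covLip+1)·Lε ≤ a⁻¹∕2·s₀⁰`
    have h1 : covLip m2 d * ((L : ℝ) * ε) ≤ (covLip m2 d + 1) * ((L : ℝ) * ε) := by
      have : 0 ≤ (L : ℝ) * ε := mul_nonneg hL0.le (le_min (by positivity) (by positivity))
      nlinarith
    nlinarith

/-- ★★★★ **KING's EFFECTIVE LAPLACIAN HAS AN `η`-UNIFORM FORM FLOOR AT EVERY CURVED BACKGROUND**: every unitary `U`, `a, m² > 0`, `L ≥ 1`, comb-depth contours: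
`((a⁻¹∕2)∕(a⁻¹+4e∕m²)²)·‖g‖² ≤ Re⟨g, Δ_eff(U)g⟩` — read off from the complex accretivity of PART Ϫ-f at `U = U₀` (no spectral theorem; PART Ϥ-k's exact sandwich on `(Δ_eff)⁻¹` is sharper).
[cite: King1986, (2.14) p.653, (4.33) p.674; Balaban1985BackgroundPropagators, (3.25) p.394] -/
theorem re_quadForm_effLapU_ge_uniform (g : Tor M × n → ℂ) :
    (a⁻¹ / 2) / (a⁻¹ + 4 / m2 * Real.exp 1) ^ 2 * ‖(toLp 2 g : EuclideanSpace ℂ (Tor M × n))‖ ^ 2 ≤ RCLike.re (star g ⬝ᵥ (effLapU T M a ((L : ℝ) ^ 2) m2 U *ᵥ g)) := by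
  obtain ⟨ε, hε, h2a, hsmall⟩ := exists_accretivity_radius (L := L) ha hm hL (d := d)
  have h0 : ∀ bd, ‖U bd - U bd‖ ≤ ε := fun bd => by rw [sub_self, norm_zero]; exact hε.le
  have h := re_quadForm_cxEffLap_ge T M hD ha hm hL hU hε h0 h2a hsmall g
  rwa [cxEffLap_inv_of_unitary T M a _ m2 hU] at h

/-- ★★★ every eigenvalue of `Δ_eff(U)` (unitary `U`) has `Re μ ≥ (a⁻¹∕2)∕(a⁻¹+4e∕m²)²`. [cite: King1986, (2.14) p.653] -/
theorem re_eigenvalue_effLapU_ge_uniform {μ : ℂ} {v : Tor M × n → ℂ} (hv : v ≠ 0) (hΔv : effLapU T M a ((L : ℝ) ^ 2) m2 U *ᵥ v = μ • v) :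
    (a⁻¹ / 2) / (a⁻¹ + 4 / m2 * Real.exp 1) ^ 2 ≤ μ.re :=
  re_eigenvalue_ge_of_quadForm M (re_quadForm_effLapU_ge_uniform T M hD ha hm hL hU) hv hΔv

/-- ★★★ **`‖Δ_eff(U)‖ ≤ (a + a²(8∕m²)e³)·K_{d+1}(ctRate(m²∕2,a,d))` AT EVERY UNITARY BACKGROUND** (`ε = 0` in PART Ϫ-g). [cite: King1986, (2.14) p.653, (4.34) p.674] -/
theorem l2_opNorm_effLapU_le_uniform : ‖effLapU T M a ((L : ℝ) ^ 2) m2 U‖ ≤ (a + a ^ 2 * (8 / m2 * Real.exp 3)) * B4Sect5Proof.latticeConst (d + 1) (ctRate (m2 / 2) a d) := by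
  have h0 : ∀ bd, ‖U bd - U bd‖ ≤ 0 := fun bd => by rw [sub_self, norm_zero]
  have h := l2_opNorm_cxEffLap_at_massRadius_le T M hD ha hm hL hU le_rfl h0 (by rw [mul_zero]; exact (sliceRadius_pos hm ha.le d).le)
  rwa [cxEffLap_inv_of_unitary T M a _ m2 hU] at h

/-- ★★★ **THE GAUSSIAN NORMALISATION AT EVERY UNITARY BACKGROUND IS PINNED**: `β₁^N ≤ |det Δ_eff(U)| ≤ Γ₁^N`, `N = |T_M|·n`. [cite: King1986, (2.14) p.653, (4.5) p.670] -/
theorem norm_det_effLapU_two_sided :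
    ((a⁻¹ / 2) / (a⁻¹ + 4 / m2 * Real.exp 1) ^ 2) ^ Fintype.card (Tor M × n) ≤ ‖(effLapU T M a ((L : ℝ) ^ 2) m2 U).det‖
      ∧ ‖(effLapU T M a ((L : ℝ) ^ 2) m2 U).det‖ ≤ ((a + a ^ 2 * (8 / m2 * Real.exp 3)) * B4Sect5Proof.latticeConst (d + 1) (ctRate (m2 / 2) a d)) ^ Fintype.card (Tor M × n) := by
  obtain ⟨ε, hε, h2a, hsmall⟩ := exists_accretivity_radius (L := L) ha hm hL (d := d)
  have h0 : ∀ bd, ‖U bd - U bd‖ ≤ ε := fun bd => by rw [sub_self, norm_zero]; exact hε.le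
  have h1 := pow_le_norm_det_cxEffLap T M hD ha hm hL hU hε h0 h2a hsmall
  have h2 := norm_det_cxEffLap_le_pow T M hD ha hm hL hU hε h0 h2a
  rw [cxEffLap_inv_of_unitary T M a _ m2 hU] at h1 h2
  exact ⟨h1, h2⟩

end RealSlice

/-! ## §2 The package -/

section Package

variable (hD : ∀ j, T.depth j ≤ (d + 1) * (L - 1)) {a m2 : ℝ} (ha : 0 < a) (hm : 0 < m2) (hL : 1 ≤ L)
variable {U₀ : Tor (fine L M) × Fin (d + 1) → Matrix n n ℂ} (hU₀ : ∀ bd, U₀ bd ∈ Matrix.unitaryGroup n ℂ)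
include hD ha hm hL hU₀

/-- ★★★★ **THE PACKAGE — NE2's UNIT LAYER IN THE COMPLEX WINDOW AROUND EVERY UNITARY BACKGROUND** (`a, m² > 0`, `L ≥ 1`, comb-depth contours, fibre `ℂⁿ`, any curvature of `U₀`):
(1) for complex `U` with `‖U_b − U₀_b‖ ≤ ε`, `Lε ≤ s₀(m²,a,d)`: `Δ_eff(U,U⁻¹)` invertible, `(Δ_eff(U,U⁻¹))⁻¹ = C(U,U⁻¹) = a⁻¹1 + Q(U)B(U,U⁻¹)⁻¹Q♯_K(U⁻¹)`, `‖C(U,U⁻¹)‖ ≤ a⁻¹ + 4e∕m²`,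
`‖blk C(U,U⁻¹) y y′‖ ≤ a⁻¹[y=y′] + (8∕m²)e³e^{−ctRate(m²∕2,0,d)d_M(y,y′)}`; (2) `U ↦ (Δ_eff(U,U⁻¹))⁻¹` analytic on the open polydisc `s₀(m²,a,d)∕L`; (3) complex `U` with `0 < ε`, `2Lε ≤ s₀(m²,0,d)`:
`‖blk(C(U,U⁻¹) − C(U₀,U₀⁻¹)) y y′‖ ≤ (16∕m²)e³(Lε∕s₀(m²,0,d))e^{−ctRate(m²∕2,0,d)d_M(y,y′)}`; (4) in the accretivity window (`2Lε ≤ s₀(m²,a,d)`, `covLip·Lε∕s₀(m²,0,d) ≤ a⁻¹∕2`):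
`β₁‖g‖² ≤ Re⟨g,Δ_eff(U,U⁻¹)g⟩` and `β₁^N ≤ |det Δ_eff(U,U⁻¹)| ≤ Γ₁^N`. [cite: King1986, (2.14) p.653, (4.32)–(4.34) p.674, (4.33) p.674, Lemma 4.5 (4.38) p.674, (4.44) p.675; Balaban1985BackgroundPropagators, §3.B p.399 l.37–40, Thm 3.4 p.400] -/
theorem king_blockCov_complex_window_package :
    (∀ (U : Tor (fine L M) × Fin (d + 1) → Matrix n n ℂ) (ε : ℝ), 0 ≤ ε → (∀ bd, ‖U bd - U₀ bd‖ ≤ ε) → (L : ℝ) * ε ≤ sliceRadius m2 a d →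
        IsUnit (cxEffLap T M a ((L : ℝ) ^ 2) m2 U (fun bd => (U bd)⁻¹))
        ∧ (cxEffLap T M a ((L : ℝ) ^ 2) m2 U (fun bd => (U bd)⁻¹))⁻¹ = cxBlockCov T M a ((L : ℝ) ^ 2) m2 U (fun bd => (U bd)⁻¹)
        ∧ ‖cxBlockCov T M a ((L : ℝ) ^ 2) m2 U (fun bd => (U bd)⁻¹)‖ ≤ a⁻¹ + 4 / m2 * Real.exp 1
        ∧ ∀ y y' : Tor M, ‖blk (cxBlockCov T M a ((L : ℝ) ^ 2) m2 U (fun bd => (U bd)⁻¹)) y y'‖ ≤ (if y = y' then a⁻¹ else 0) + 8 / m2 * Real.exp 3 * Real.exp (-(ctRate (m2 / 2) 0 d * tdistT M y y')))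
    ∧ AnalyticOnNhd ℂ (fun W : Tor (fine L M) × Fin (d + 1) → Matrix n n ℂ => (cxEffLap T M a ((L : ℝ) ^ 2) m2 W (fun bd => (W bd)⁻¹))⁻¹) {U | ∀ bd, ‖U bd - U₀ bd‖ < sliceRadius m2 a d / L}
    ∧ (∀ (U : Tor (fine L M) × Fin (d + 1) → Matrix n n ℂ) (ε : ℝ), 0 < ε → (∀ bd, ‖U bd - U₀ bd‖ ≤ ε) → 2 * ((L : ℝ) * ε) ≤ sliceRadius m2 0 d →
        ∀ y y' : Tor M, ‖blk (cxBlockCov T M a ((L : ℝ) ^ 2) m2 U (fun bd => (U bd)⁻¹) - cxBlockCov T M a ((L : ℝ) ^ 2) m2 U₀ (fun bd => (U₀ bd)⁻¹)) y y'‖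
          ≤ 16 / m2 * Real.exp 3 * ((L : ℝ) * ε / sliceRadius m2 0 d) * Real.exp (-(ctRate (m2 / 2) 0 d * tdistT M y y')))
    ∧ (∀ (U : Tor (fine L M) × Fin (d + 1) → Matrix n n ℂ) (ε : ℝ), 0 < ε → (∀ bd, ‖U bd - U₀ bd‖ ≤ ε) → 2 * ((L : ℝ) * ε) ≤ sliceRadius m2 a d →
        covLip m2 d * ((L : ℝ) * ε / sliceRadius m2 0 d) ≤ a⁻¹ / 2 →
        (∀ g : Tor M × n → ℂ, (a⁻¹ / 2) / (a⁻¹ + 4 / m2 * Real.exp 1) ^ 2 * ‖(toLp 2 g : EuclideanSpace ℂ (Tor M × n))‖ ^ 2 ≤ RCLike.re (star g ⬝ᵥ (cxEffLap T M a ((L : ℝ) ^ 2) m2 U (fun bd => (U bd)⁻¹) *ᵥ g)))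
        ∧ ((a⁻¹ / 2) / (a⁻¹ + 4 / m2 * Real.exp 1) ^ 2) ^ Fintype.card (Tor M × n) ≤ ‖(cxEffLap T M a ((L : ℝ) ^ 2) m2 U (fun bd => (U bd)⁻¹)).det‖
        ∧ ‖(cxEffLap T M a ((L : ℝ) ^ 2) m2 U (fun bd => (U bd)⁻¹)).det‖ ≤ ((a + a ^ 2 * (8 / m2 * Real.exp 3)) * B4Sect5Proof.latticeConst (d + 1) (ctRate (m2 / 2) a d)) ^ Fintype.card (Tor M × n)) := by
  refine ⟨fun U ε hε0 hU hrad => ⟨isUnit_cxEffLap_at_massRadius T M hD ha hm hL hU₀ hε0 hU hrad, inv_cxEffLap_at_massRadius T M hD ha hm hL hU₀ hε0 hU hrad,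
      l2_opNorm_cxBlockCov_at_massRadius_le T M hD ha hm hL hU₀ hε0 hU hrad, norm_blk_cxBlockCov_at_massRadius_le T M hD ha hm hL hU₀ hε0 hU hrad⟩,
    analyticOnNhd_inv_printEffLap_polydisc T M hD hL hU₀ ha hm,
    fun U ε hε hU h2 => norm_blk_cxBlockCov_sub_le_eta_uniform T M hD hm hL hU₀ hε hU h2,
    fun U ε hε hU h2a hsmall => ⟨re_quadForm_cxEffLap_ge T M hD ha hm hL hU₀ hε hU h2a hsmall, pow_le_norm_det_cxEffLap T M hD ha hm hL hU₀ hε hU h2a hsmall,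
      norm_det_cxEffLap_le_pow T M hD ha hm hL hU₀ hε hU h2a⟩⟩

end Package

/-! ## §3 What the complexification adds — and what it does not -/

section Honest

variable (hD : ∀ j, T.depth j ≤ (d + 1) * (L - 1)) {a m2 : ℝ} (ha : 0 < a) (hm : 0 < m2) (hL : 1 ≤ L)
variable {U₀ : Tor (fine L M) × Fin (d + 1) → Matrix n n ℂ} (hU₀ : ∀ bd, U₀ bd ∈ Matrix.unitaryGroup n ℂ)
include hD ha hm hL hU₀

/-- ★★★ **WHAT THE COMPLEXIFICATION ADDS (AND COSTS)**: (1) the certified radius is at most `m²∕(240(d+1)(1+a))·η` in the link variables — it CLOSES WITH THE FINE MASS (at `m² = 0` the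
block-field covariance does not exist at a flat background); (2) the Woodbury form `U ↦ C(U,U⁻¹)` is analytic on the LARGER polydisc `s₀(m²,0,d)∕L`, beyond the window `s₀(m²,a,d)∕L` on which
it is certified to invert `Δ_eff(U,U⁻¹)`; (3) on the real slice the EXACT sandwich `a⁻¹‖f‖² ≤ ⟨f,(Δ_eff(U₀))⁻¹f⟩ ≤ (a⁻¹+m⁻²)‖f‖²` (PART Ϥ-k) holds at every unitary background — sharper than
the window's constants `a⁻¹ + 4e∕m²` and `β₁`. [cite: King1986, (2.14) p.653, (4.44) p.675; Balaban1985BackgroundPropagators, §3.B p.399 l.37–40, Thm 3.4 p.400] -/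
theorem king_blockCov_what_the_complexification_adds :
    (sliceRadius m2 a d ≤ m2 / (240 * ((d : ℝ) + 1) * (1 + a)) ∧ sliceRadius m2 a d ≤ sliceRadius m2 0 d)
    ∧ AnalyticOnNhd ℂ (fun W : Tor (fine L M) × Fin (d + 1) → Matrix n n ℂ => cxBlockCov T M a ((L : ℝ) ^ 2) m2 W (fun bd => (W bd)⁻¹)) {U | ∀ bd, ‖U bd - U₀ bd‖ < sliceRadius m2 0 d / L}
    ∧ (∀ f : Tor M × n → ℂ, a⁻¹ * ‖(toLp 2 f : EuclideanSpace ℂ (Tor M × n))‖ ^ 2 ≤ RCLike.re (star f ⬝ᵥ ((effLapU T M a ((L : ℝ) ^ 2) m2 U₀)⁻¹ *ᵥ f))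
        ∧ RCLike.re (star f ⬝ᵥ ((effLapU T M a ((L : ℝ) ^ 2) m2 U₀)⁻¹ *ᵥ f)) ≤ (a⁻¹ + m2⁻¹) * ‖(toLp 2 f : EuclideanSpace ℂ (Tor M × n))‖ ^ 2) :=
  ⟨⟨(sliceRadius_le m2 a d).2, sliceRadius_anti hm.le ha.le d⟩, analyticOnNhd_printBlockCov_polydisc T M hD a hm hL hU₀,
    fun f => king_blockField_covariance_sandwich T M ha (by positivity) hm hU₀ f⟩

end Honest

end Summit.QuantumFields.YangMills.BalabanUVNodes.N15KingModelRung.Analytic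

end
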